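import Literature.Topology.FourManifolds.MMSWRasmussenFacts
import Literature.Topology.FourManifolds.ProjectiveTowers
import HarnessLib

/-!
# MMSW's adjunction inequality for `s₋` in `♮ᵏ(B² × S²) # #ᵗℂℙ²bar` — knots bounding discs (named fact)

Companion of `MMSWRasmussen.lean` / `MMSWRasmussenFacts.lean` (the invariants `s₋`, `s₊` of a null-homologous
knot in the model `M_k = ∂D_k ⊂ ℝ⁴` of `#ᵏ(S¹ × S²)`) and of `ProjectiveTowers.lean` (oriented `ℂℙ²`-towers
`#ᵗ(ℂℙ², o)` and the `S³`-knot case `Knot.rasmussen_nonpos_of_isTowerSlice` of MMSW's Cor. 1.9).  Wanted by route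
`SmoothPoincare4/DottedCircleRasmussen`, item `DcrAdjunction` (the "`M_k`-adjunction").

Manolescu–Marengon–Sarkar–Willis prove:

* Thm. 8.10, first bullet (= Thm. 6.10, `s = s₋`): for an oriented cobordism `Σ ⊂ Z = (I × M_r) # (#ᵗℂℙ²bar)` from a
  null-homologous link `L₁` to a null-homologous link `L₂` with `[Σ] = 0 ∈ H₂(Z, ∂Z)` and every component of `Σ`
  meeting `L₂`: `s₋(L₁) − s₋(L₂) ≥ χ(Σ)`;
* Lemma 8.19 (`t = 0`): for a null-homologous `ℓ`-component link `L ⊂ M_r` and a properly embedded `Σ ⊂ ♮ʳ(B² × S²)`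
  with `σ` components, none closed, `∂Σ = L`: `s₋(L) ≤ 1 − χ(Σ) = 2g + ℓ − 2σ + 1` — proved by removing a
  neighbourhood of the `S²`-cores `A` (`♮ʳ(B² × S²) ∖ ν(A) = I × M_r`), which turns `Σ` into a cobordism `Σ°` from
  `⊔ᵢ F_{pᵢ,pᵢ}` to `L`, and applying the cobordism inequality with `s₋(F_{p,p}) = 1 − 2p` (Thm. 1.6).

The same ten lines with Thm. 8.10 in place of Cor. 8.11 give the `(r, t)`-form: for `Σ ⊂ W = ♮ʳ(B² × S²) # #ᵗℂℙ²bar`,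
properly embedded, no closed components, `∂Σ = L` null-homologous, and `[Σ] = 0 ∈ H₂(W, ∂W)` (which makes all
`[Σ°] · [ℂℙ¹ᵢ]` vanish, i.e. `[Σ°] = 0 ∈ H₂(Z, ∂Z)` since `∂Σ°` consists of null-homologous links):
`s₋(L) ≤ 1 − χ(Σ)`.  Its `r = 0` case is the printed Cor. 1.9 / Cor. 6.12, its `t = 0` case Lemma 8.19.

This file states the KNOT/DISC case (`ℓ = σ = 1`, `g = 0`: **`s₋(K) ≤ 0`**) of that `(r, t)`-form as a named fact,
in the tree's vocabulary and with the two devices of `ProjectiveTowers.lean`: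

* `W` is presented as `P ∖ e(D̊_k)` for a `t`-fold `o`-tower `(P, oP)` (`IsProjectiveTower o t P oP`) and a smooth
  chart `e : ℝ⁴ → P` carrying the model handlebody `D_k`, ORIENTATION PRESERVING from the standard `ℝ⁴` to `(P, oP)`
  (this is what distinguishes `K` from its mirror `ρ ∘ K`); the disc is the route's `MMSW.IsSliceDiscInComplement`.
* "`[Σ] = 0 ∈ H₂(W, ∂W)`" is replaced by the sufficient, homology-light condition of `Knot.IsTowerSlice`: `e(ℝ⁴)` and
  `f(ℝ²)` lie in an open `U ⊆ P` with `H₂(U; ℤ) = 0`.  (Then `H₂(U, e D_k) ↪ H₁(e D_k)` as `H₂(U) = 0`, and the disc's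
  class maps to `[e ∘ K] = 0` because `K` is null-homologous in `∂D_k` and `H₁(∂D_k) ≅ H₁(D_k)`; so the disc is
  null-homologous in `(U ∖ e D̊_k, e ∂D_k)`, hence in `(W, ∂W)`.)  In the application to a homotopy `4`-sphere `Σ` with
  `Σ # tℂℙ²bar ≅ #ᵗℂℙ²bar` one takes `U = Σ ∖ pt`.
* `∃ o`: the inequality holds for ONE of the two orientations `o` of the tree's `ComplexProjectivePlane` — the one
  whose `o`-towers, glued to the orientation-preservingly charted complement of `D_k`, are the printed `#ᵗℂℙ²bar`
  relative to MMSW's orientation of `M_k = ∂(♮ᵏ S¹ × B³)`; the other orientation satisfies the mirrored inequality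
  `0 ≤ s₊` (`sPlus_nonneg_of_isTowerSliceInComplement_modelMirror`).  As in `Knot.rasmussen_nonpos_of_isTowerSlice`
  this makes the statement independent of every sign convention of the tree (which orientation of `ℂℙ²` is the
  complex one; the boundary-orientation convention inside the model `M_k`, `MMSWRasmussen` module docstring).

At height `t = 0` (`P ≅ S⁴`, either `o`) the fact is the `S⁴`-form of the vendored Lemma 8.19
(`MMSW.sMinus_nonpos_of_isModelSliceDisc`, stated there for `e = id` on `ℝ⁴`):
`sMinus_nonpos_of_isSliceDiscInComplement_sphere`.

## What is NOT here (scope)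

* Links, surfaces of genus `g > 0` or with several components, and the genuine hypothesis `[Σ] = 0 ∈ H₂(W, ∂W)`
  (relative `H₂` of manifolds with boundary is not in the tree).
  `-- TODO(general form): s₋(L) ≤ 2g(Σ) + ℓ − 2σ + 1 for Σ ⊂ ♮ʳ(B² × S²) # #ᵗℂℙ²bar with [Σ] = 0 rel ∂.`
* The `s₊`-version for surfaces in `♮ʳ(S¹ × B³) # #ᵗℂℙ²bar` (Thm. 8.10, second bullet) and cobordisms in
  `(I × M_r) # #ᵗℂℙ²bar` themselves.
* Any proof: the printed one rests on Khovanov–Lee homology in `#ʳ(S¹ × S²)` (Rozansky, Willis) and the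
  computation `s(F_p(1)) = 1 − 2p`, absent from the tree.

## References

* C. Manolescu, M. Marengon, S. Sarkar, M. Willis, *A generalization of Rasmussen's invariant, with applications to
  surfaces in some four-manifolds*, Duke Math. J. 172 (2023) 231–311, arXiv:1910.08195: Thm. 1.6, Cor. 1.9
  (= Cor. 6.12), Def. 6.2, Thm. 6.10, Thm. 8.10, Def. 8.14, Remark 8.15, Lemma 8.19 (with its proof, p. 25).
  [ManolescuMarengonSarkarWillis2023]
* R. Kirby, *The Topology of 4-Manifolds*, LNM 1374 (1989), Ch. I §2 (`S⁴ ∖ (0 ∪ 1-handles)° ≅ ♮ᵏ(B² × S²)`).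
  [Kirby1989]
-/

open scoped Manifold ContDiff Topology
open Function Set

namespace Literature.Topology.FourManifolds

/-- Local notation: `𝔼 n` is the model Euclidean space `EuclideanSpace ℝ (Fin n)`. -/
local notation "𝔼 " n:arg => EuclideanSpace ℝ (Fin n)

/-- Local notation: `𝕊 n` is the unit sphere in `EuclideanSpace ℝ (Fin (n + 1))`. -/
local notation "𝕊 " n:arg => (Metric.sphere (0 : EuclideanSpace ℝ (Fin (n + 1))) 1)

namespace MMSW

/-- **Tower-slice data for a model knot, in the complement of the dotted handlebody** (the `#ᵏ(S¹ × S²)`-analogue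
of `Knot.IsTowerSlice`, MMSW Def. 6.2 / Def. 8.14).  `IsTowerSliceInComplement o k K`: for some `t`, some `t`-fold
`o`-tower `(P, oP)` (`IsProjectiveTower o t P oP`, i.e. `#ᵗ(ℂℙ², o)`), some smooth chart `e : ℝ⁴ → P` which is
ORIENTATION PRESERVING from the standard `ℝ⁴` to `(P, oP)`, and some `f : ℝ² → P`, the pair `(e, f)` is a slice
datum for `K ⊂ ∂D_k` in the complement of `e(D_k)` (`IsSliceDiscInComplement k K P e f`: `f|_{𝔻²}` a smooth proper
disc in `P ∖ e(D_k)` bounded by `e ∘ K`), and `e(ℝ⁴) ∪ f(ℝ²)` lies in an open `U ⊆ P` with `H₂(U; ℤ) = 0` — the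
homology-light form of "the disc is null-homologous in `(W, ∂W)`, `W = P ∖ e(D̊_k) ≅ ♮ᵏ(B² × S²) # #ᵗ(ℂℙ², o)`"
(module docstring).  A definition (predicate in `o`, `k`, `K`).
[cite: ManolescuMarengonSarkarWillis2023, Def. 6.2 and Def. 8.14] -/
def IsTowerSliceInComplement (o : SmoothOrientation (𝓡 4) ComplexProjectivePlane) (k : ℕ) (K : 𝕊 1 → 𝔼 4) :
    Prop :=
  ∃ (t : ℕ) (P : Type) (_ : TopologicalSpace P) (_ : T2Space P) (_ : SecondCountableTopology P)
    (_ : ChartedSpace (𝔼 4) P) (_ : IsManifold (𝓡 4) ∞ P) (_ : CompactSpace P)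
    (oP : SmoothOrientation (𝓡 4) P) (e : 𝔼 4 → P) (f : 𝔼 2 → P),
    IsProjectiveTower o t P oP ∧ IsSliceDiscInComplement k K P e f ∧
      IsOrientationPreserving (SmoothOrientation.euclidean 4) oP e ∧
      ∃ U : TopologicalSpace.Opens P, (∀ v, e v ∈ U) ∧ (∀ y, f y ∈ U) ∧
        CategoryTheory.Limits.IsZero (singularHomologyZ (↥U) 2)

/-- **MMSW 2023, the adjunction inequality for `s₋` in `♮ᵏ(B² × S²) # #ᵗℂℙ²bar`, knot/disc case — NAMED FACT.**
For ONE of the two orientations `o` of `ℂℙ²`: every model knot `K ⊂ M_k = ∂D_k` with `s₋(K) = s` that is tower-slice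
in the complement over `o` (`IsTowerSliceInComplement o k K`: bounds a null-homologous smooth proper disc in
`#ᵗ(ℂℙ², o) ∖ e(D_k)` for an orientation-preserving chart `e`) has `s ≤ 0`.  This is the case `ℓ = σ = 1`, `g = 0`
of "`s₋(L) ≤ 1 − χ(Σ)` for a properly embedded `Σ ⊂ ♮ᵏ(B² × S²) # #ᵗℂℙ²bar` without closed components, bounded by
the null-homologous link `L ⊂ #ᵏ(S¹ × S²)`, with `[Σ] = 0 ∈ H₂(rel ∂)`", which is Thm. 8.10 (first bullet:
`s₋(L₁) − s₋(L₂) ≥ χ(Σ)` for null-homologous cobordisms in `(I × M_k) # #ᵗℂℙ²bar` all of whose components meet `L₂`)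
applied, word for word as in the proof of Lemma 8.19 (its case `t = 0`), to the cobordism `Σ° = Σ ∖ ν(A)` from
`⊔ᵢ F_{pᵢ,pᵢ}` to `L` obtained by deleting a neighbourhood of the `S²`-cores, together with
`s₋(⊔ᵢ F_{pᵢ,pᵢ}) = 1 − Σᵢ 2pᵢ` (Thm. 1.6 and disjoint union); its case `k = 0` is Cor. 1.9 (= Cor. 6.12,
`Knot.rasmussen_nonpos_of_isTowerSlice`).  Users take `(h : MMSW.sMinus_nonpos_of_isTowerSliceInComplement)`.
`-- TODO(general form): links and surfaces, s₋(L) ≤ 2g(Σ) + ℓ − 2σ + 1, hypothesis [Σ] = 0 ∈ H₂(W, ∂W).`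
[cite: ManolescuMarengonSarkarWillis2023, Thm. 8.10, Lemma 8.19 and Thm. 1.6] -/
def sMinus_nonpos_of_isTowerSliceInComplement : Prop :=
  ∃ o : SmoothOrientation (𝓡 4) ComplexProjectivePlane,
    ∀ {k : ℕ} {K : 𝕊 1 → 𝔼 4} {s : ℤ} (_hK : IsTowerSliceInComplement o k K) (_hs : HasSMinus k K s), s ≤ 0

variable {k : ℕ} {K : 𝕊 1 → 𝔼 4}

/-- Tower-slice data only exist for model knots sliced in the complement: unfolding, the datum `(e, f)` is an
`IsSliceDiscInComplement` datum in some `o`-tower. [cite: ManolescuMarengonSarkarWillis2023, Def. 8.14] -/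
theorem IsTowerSliceInComplement.exists_isSliceDiscInComplement {o : SmoothOrientation (𝓡 4) ComplexProjectivePlane}
    (h : IsTowerSliceInComplement o k K) :
    ∃ (t : ℕ) (P : Type) (_ : TopologicalSpace P) (_ : T2Space P) (_ : SecondCountableTopology P)
      (_ : ChartedSpace (𝔼 4) P) (_ : IsManifold (𝓡 4) ∞ P) (_ : CompactSpace P)
      (oP : SmoothOrientation (𝓡 4) P) (e : 𝔼 4 → P) (f : 𝔼 2 → P),
      IsProjectiveTower o t P oP ∧ IsSliceDiscInComplement k K P e f := by
  obtain ⟨t, P, _, _, _, _, _, _, oP, e, f, hP, hf, -, -⟩ := h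
  exact ⟨t, P, _, ‹_›, ‹_›, _, ‹_›, ‹_›, oP, e, f, hP, hf⟩

/-- **Height `0`: slicing in the complement of `D_k` inside a standard `S⁴`.**  A slice datum `(e, f)` for `K` in
`P ∖ e(D_k)` with `P ≅ S⁴`, `e` orientation preserving for some orientation `oP` of `P`, and `e(ℝ⁴) ∪ f(ℝ²)` inside
an open `U` with `H₂(U; ℤ) = 0`, is a tower-slice datum of height `0` over EVERY orientation `o` of `ℂℙ²` (height `0`
is orientation-free, `isProjectiveTower_zero_iff`). [cite: ManolescuMarengonSarkarWillis2023, §6 and Def. 8.14] -/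
theorem isTowerSliceInComplement_of_sphere (o : SmoothOrientation (𝓡 4) ComplexProjectivePlane)
    {P : Type} [TopologicalSpace P] [T2Space P] [SecondCountableTopology P] [ChartedSpace (𝔼 4) P]
    [IsManifold (𝓡 4) ∞ P] [CompactSpace P] (hP : Nonempty (P ≃ₘ⟮𝓡 4, 𝓡 4⟯ 𝕊 4))
    (oP : SmoothOrientation (𝓡 4) P) {e : 𝔼 4 → P} {f : 𝔼 2 → P} (hf : IsSliceDiscInComplement k K P e f)
    (he : IsOrientationPreserving (SmoothOrientation.euclidean 4) oP e)
    (hU : ∃ U : TopologicalSpace.Opens P, (∀ v, e v ∈ U) ∧ (∀ y, f y ∈ U) ∧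
      CategoryTheory.Limits.IsZero (singularHomologyZ (↥U) 2)) :
    IsTowerSliceInComplement o k K :=
  ⟨0, P, _, ‹_›, ‹_›, _, ‹_›, ‹_›, oP, e, f, (isProjectiveTower_zero_iff o P oP).2 hP, hf, he, hU⟩

/-- **The fact at height `0`** (the `S⁴`-form of Lemma 8.19 for discs, cf. `sMinus_nonpos_of_isModelSliceDisc`):
GIVEN the named fact, a model knot with `s₋(K) = s` sliced in `P ∖ e(D_k)`, `P ≅ S⁴`, by an orientation-preserving
chart `e` and inside an open `U` with `H₂(U; ℤ) = 0`, has `s ≤ 0` — whichever orientation `o` the fact picks.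
[cite: ManolescuMarengonSarkarWillis2023, Lemma 8.19] -/
theorem sMinus_nonpos_of_isSliceDiscInComplement_sphere (h : sMinus_nonpos_of_isTowerSliceInComplement)
    {P : Type} [TopologicalSpace P] [T2Space P] [SecondCountableTopology P] [ChartedSpace (𝔼 4) P]
    [IsManifold (𝓡 4) ∞ P] [CompactSpace P] (hP : Nonempty (P ≃ₘ⟮𝓡 4, 𝓡 4⟯ 𝕊 4))
    (oP : SmoothOrientation (𝓡 4) P) {e : 𝔼 4 → P} {f : 𝔼 2 → P} (hf : IsSliceDiscInComplement k K P e f)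
    (he : IsOrientationPreserving (SmoothOrientation.euclidean 4) oP e)
    (hU : ∃ U : TopologicalSpace.Opens P, (∀ v, e v ∈ U) ∧ (∀ y, f y ∈ U) ∧
      CategoryTheory.Limits.IsZero (singularHomologyZ (↥U) 2))
    {s : ℤ} (hs : HasSMinus k K s) : s ≤ 0 := by
  obtain ⟨o, ho⟩ := h
  exact ho (isTowerSliceInComplement_of_sphere o hP oP hf he hU) hs

/-- **The mirrored inequality `0 ≤ s₊`.**  For the orientation `o` picked by the fact: if the MIRROR `ρ ∘ K`
(`modelMirror`, `ρ(z, w) = (z̄, w)`) of a model knot `K` with `s₊(K) = s` is tower-slice in the complement over `o`,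
then `0 ≤ s` — because `s₊(K) = −s₋(ρ ∘ K)` by definition (`HasSPlus`).  Reflecting a slice datum `(e, f)` for `K`
by the linear reflection of `ℝ⁴` extending `ρ` (which preserves `D_k` and reverses orientation) produces one for
`ρ ∘ K` in `(P, −oP)`, a `(−o)`-tower (`IsProjectiveTower.neg`); so both windows `s₋ ≤ 0 ≤ s₊` need towers over
BOTH orientations — MMSW's two dissolutions `X # ℂℙ² ≅ ℂℙ²`, `X # ℂℙ²bar ≅ ℂℙ²bar` in Cor. 1.13 / §9.3.
[cite: ManolescuMarengonSarkarWillis2023, Prop. 8.8 (1) and proof of Cor. 6.15] -/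
theorem sPlus_nonneg_of_isTowerSliceInComplement_modelMirror {o : SmoothOrientation (𝓡 4) ComplexProjectivePlane}
    (ho : ∀ {k : ℕ} {K : 𝕊 1 → 𝔼 4} {s : ℤ}, IsTowerSliceInComplement o k K → HasSMinus k K s → s ≤ 0)
    (h : IsTowerSliceInComplement o k (modelMirror ∘ K)) {s : ℤ} (hs : HasSPlus k K s) : 0 ≤ s := by
  have := ho h hs
  omega

/-- **The slice window for the picked orientation**: if both `K` and its mirror `ρ ∘ K` are tower-slice in the
complement over the orientation `o` of the fact, then `s₋(K) ≤ 0 ≤ s₊(K)` — the shape in which MMSW's Cor. 1.13 /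
§9.3 use the adjunction (`L` and `L̄` both strongly H-slice in `#ᵗℂℙ²bar`).
[cite: ManolescuMarengonSarkarWillis2023, proof of Cor. 6.15] -/
theorem sMinus_nonpos_sPlus_nonneg_of_isTowerSliceInComplement
    {o : SmoothOrientation (𝓡 4) ComplexProjectivePlane}
    (ho : ∀ {k : ℕ} {K : 𝕊 1 → 𝔼 4} {s : ℤ}, IsTowerSliceInComplement o k K → HasSMinus k K s → s ≤ 0)
    (h : IsTowerSliceInComplement o k K) (h' : IsTowerSliceInComplement o k (modelMirror ∘ K))
    {s₁ s₂ : ℤ} (h₁ : HasSMinus k K s₁) (h₂ : HasSPlus k K s₂) : s₁ ≤ 0 ∧ 0 ≤ s₂ :=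
  ⟨ho h h₁, sPlus_nonneg_of_isTowerSliceInComplement_modelMirror ho h' h₂⟩

end MMSW

namespace MMSWRasmussen

variable {k : ℕ} {K : 𝕊 1 → 𝔼 4}

/-- **The adjunction for the bundled invariant**: GIVEN the named fact, for its orientation `o`, a knot with MMSW
invariants that is tower-slice in the complement over `o` has `s₋ ≤ 0`, and if its mirror is too, `0 ≤ s₊`
(route items quantify over `w : MMSWRasmussen k K`). [cite: ManolescuMarengonSarkarWillis2023, Thm. 8.10 and Lemma 8.19] -/
theorem exists_sMinus_nonpos_of_isTowerSliceInComplement (h : MMSW.sMinus_nonpos_of_isTowerSliceInComplement) :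
    ∃ o : SmoothOrientation (𝓡 4) ComplexProjectivePlane,
      ∀ {k : ℕ} {K : 𝕊 1 → 𝔼 4} (w : MMSWRasmussen k K),
        (MMSW.IsTowerSliceInComplement o k K → w.sMinus ≤ 0) ∧
          (MMSW.IsTowerSliceInComplement o k (MMSW.modelMirror ∘ K) → 0 ≤ w.sPlus) := by
  obtain ⟨o, ho⟩ := h
  exact ⟨o, fun w ↦ ⟨fun hK ↦ ho hK w.hasSMinus,
    fun hK ↦ MMSW.sPlus_nonneg_of_isTowerSliceInComplement_modelMirror ho hK w.hasSPlus⟩⟩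

end MMSWRasmussen

end Literature.Topology.FourManifolds
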